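import Summits.Ventures.FusionMHD.Models.SolovevMercierAxisRegularNearAxis
import Summits.Ventures.FusionMHD.Models.SolovevPCFSafetyFactorProfile
import Summits.Ventures.FusionMHD.Bench.SolovevPCFNstxMercierAxis
import Summits.Ventures.FusionMHD.Bench.SolovevPCFNstxMercierEdgeKernel
import HarnessLib

/-!
# F1 / MERCIER — NSTX-like PCF Solov'ev model: the flux-surface Mercier threshold `g_M(r)` CONVERGES, as the surface
# shrinks to the magnetic axis, to the certified near-axis (Bateman) threshold `F_M ∈ [FmercLo, FmercHi)` (`≈ 1.11855…`, width `10⁻²⁰`)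
(venture LADDER-GRIDFUSION, rung F1.MERCIER; cell `gridfusion`, seat `gridfusion-model-7` (g4), 2026-08-27; NSTX-like twin of `SolovevPCFIterMercierAxisLimit`; instance corollary
of the generic `Models/SolovevMercierAxisRegular*` set — ★ candidate #112 «F1.MERCIER-NEARAXIS-LIMIT-THM».)

The cell holds TWO printed Mercier criteria on this model: the near-axis form (Bateman (7.3.2), `Mercier.NearAxis.MercierCriterion`,
certified axis threshold bracket `[FmercLo, FmercHi]` of width `10⁻²⁰`, `Bench/SolovevPCFNstxMercierAxis`) and the
flux-surface form (Jardin (8.134) on model-5's records `lcGGJData κ₀ F R_a q₀(F) (ε/R_a) F r`, certified two-sided thresholds on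
the certified surfaces and the axis row; `…NstxMercierNearAxisProfile` records the APPROACH as numbers).  THIS
FILE proves the limit statement for the instance, and (§0) supplies the `F`-free form of the regular numerators
(`slopeNumNstx`, `interceptNumNstx`, `lcRegNum_nstx`) with the whole-profile glue `mercier_wholeProfile_nstx` for a kernel
certificate «F1.MERCIER-WHOLE-PROFILE-NSTX» (#105′):
* `FmercAxis` — the exact axis threshold `√(κ₀(κ₀+1)(κ₀²+1)/(2r_q(κ₀²+3κ₀−2)))` (`κ₀² = Ψ_RR/Ψ_ZZ = 3382585600/833319279`, `r_q = q₀²/F²` exact);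
  `mercierNearAxis_iff`: for `F > 0`, Bateman's criterion `MercierCriterion (q₀ F) κ₀ 0 0 ↔ FmercAxis < F`; hence
  `FmercAxis_mem`: **`FmercLo ≤ FmercAxis < FmercHi`** from the two certified axis rows (no new numerics);
* **`tendsto_mercierThreshold_axis`** — for every `F > 0`: `lcMercierThreshold κ₀ F R_a (q₀ F) (ε/R_a) r → FmercAxis` as
  `r → 0⁺` (the threshold of the record `lcGGJData κ₀ F R_a (q₀ F) (ε/R_a) · r` is `F`-free): the certified profile
  of the NSTX-like surfaces converges to the certified axis value — a THEOREM now;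
* **`eventually_mercier_of_lt` / `eventually_not_mercier_of_lt`** — for `F > F_M` (in particular `F ≥ FmercHi`) the
  flux-surface criterion (8.134) holds on every surface close enough to the axis — UNIFORMLY (`eventually_forall_mercier_of_lt`:
  one neighbourhood of the axis for all `F ≥ G > F_M`); for `0 < F < F_M` (in particular `F < FmercLo`) it fails there.
HONEST FRAMING: CERTIFIED/PROVED statements about the MODEL (ideal MHD, analytic fixed-boundary PCF Solov'ev equilibrium
[cite: PatakiCerfonFreidberg2013, §6.1], `F = RB_φ` free); Mercier is a NECESSARY local-interchange criterion; nothing here says a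
plasma or device is stable. No `decide`, no kit.
-/

noncomputable section

open Real Set Filter Topology
open Literature.MathematicalPhysics.MHD Literature.MathematicalPhysics.MHD.Solovev
open Literature.MathematicalPhysics.MHD.GradShafranov Literature.MathematicalPhysics.MHD.Mercier.NearAxis
open Summit.Ventures.FusionMHD.Models.SolovevPCF
open Summit.Ventures.FusionMHD.Models.LcMercierRegular

namespace Summit.Ventures.FusionMHD.Bench.SolovevPCFNstx.MercierAxisLimit

/-! ## §0 F-elimination for the whole-profile certificate (#105): the regular numerators of the instance are F-free -/

/-- The `F`-free Lee–Cerfon amplitude of the instance: `k = κ₀F/(R_a²q₀(F)) = 2(1/2 + 4d₃)R_a` (`lcAmplitude`).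
[cite: PatakiCerfonFreidberg2013, §6.1] -/
def kNstx : ℝ := 2 * (1 / 2 + 4 * NstxLike.d₃) * NstxLike.Ra

/-- `κ₀F/(R_a²q₀(F)) = kNstx` for every `F > 0`. [cite: PatakiCerfonFreidberg2013, §6.1] -/
theorem k_eq_kNstx {F : ℝ} (hF : 0 < F) : NstxLike.kappa0 * F / (NstxLike.Ra ^ 2 * NstxLike.q0 F) = kNstx := by
  have h := NstxLike.lcAmplitude hF.ne'
  have hR := NstxLike.Ra_pos
  have hq := NstxLike.q0_pos hF
  rw [div_eq_iff (by positivity)] at h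
  unfold kNstx
  rw [div_eq_iff (by positivity), h]
  ring

/-- The `F`-FREE regular slope numerator of the instance, `N₂(r)` with `C_s = 1`, `k = kNstx`: a polynomial in the nine
regular integrals at `(κ₀, R_a, r)`. [cite: Jardin2010, §8.5.4 eq. (8.134)] -/
def slopeNumNstx (r : ℝ) : ℝ :=
  9 * r ^ 2 * kNstx ^ 2 * lcRegD5 NstxLike.Ra r ^ 2 - 6 * kNstx * lcRegD5 NstxLike.Ra r * lcRegI6 NstxLike.kappa0 NstxLike.Ra r
    + (lcRegIX NstxLike.kappa0 NstxLike.Ra r ^ 2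
        - lcRegI8 NstxLike.kappa0 NstxLike.Ra r * lcRegIY NstxLike.kappa0 NstxLike.Ra r / NstxLike.Ra ^ 2)
    + kNstx * lcRegI7 NstxLike.kappa0 NstxLike.Ra r * lcRegD3 NstxLike.Ra r

/-- The `F`-FREE regular intercept numerator of the instance, `N₀(r)` with `C_s = 1`, `k = kNstx`. [cite: Jardin2010, §8.5.4 eq. (8.134)] -/
def interceptNumNstx (r : ℝ) : ℝ :=
  kNstx ^ 2 * lcRegIB NstxLike.Ra r * lcRegI8 NstxLike.kappa0 NstxLike.Ra r
    - kNstx ^ 3 * r ^ 2 * lcRegIB NstxLike.Ra r * lcRegD3 NstxLike.Ra r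

/-- **For every `F > 0` the instance's regular numerators ARE the `F`-free ones:**
`lcRegSlopeNum κ₀ F R_a q₀(F) r = slopeNumNstx r`, `lcRegInterceptNum κ₀ F R_a q₀(F) r = interceptNumNstx r`
(`C_s = 1` by `MercierEdge.csLC_edge`, `k = kNstx`). [cite: Jardin2010, §8.5.4 eq. (8.134)] -/
theorem lcRegNum_nstx {F : ℝ} (hF : 0 < F) (r : ℝ) :
    lcRegSlopeNum NstxLike.kappa0 F NstxLike.Ra (NstxLike.q0 F) r = slopeNumNstx r
    ∧ lcRegInterceptNum NstxLike.kappa0 F NstxLike.Ra (NstxLike.q0 F) r = interceptNumNstx r := by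
  have hc := MercierEdge.csLC_edge hF
  have hk := k_eq_kNstx hF
  unfold lcRegSlopeNum lcRegInterceptNum slopeNumNstx interceptNumNstx
  rw [hc, hk]
  constructor <;> ring

/-- **WHOLE-PROFILE GLUE FOR THE INSTANCE (#105's assembly shape):** if the `F`-free cell inequality
`interceptNumNstx r < G²·slopeNumNstx r` holds for every `r ∈ (0, ε/R_a]` (all flux surfaces `0 < ψ_N ≤ 1`; `G > 0`), then
for EVERY `F ≥ G` Jardin's flux-surface Mercier criterion (8.134) holds on EVERY flux surface of the NSTX-like model.
MODELLED: ideal MHD, analytic fixed-boundary PCF equilibrium; a NECESSARY-criterion statement, never «stable».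
[cite: Jardin2010, §8.5.4 eq. (8.134)] -/
theorem mercier_wholeProfile_nstx {G : ℝ} (hG : 0 < G)
    (h : ∀ r ∈ Ioc 0 (NstxLike.ε / NstxLike.Ra), interceptNumNstx r < G ^ 2 * slopeNumNstx r) :
    ∀ F, G ≤ F → ∀ r ∈ Ioc 0 (NstxLike.ε / NstxLike.Ra),
      (lcGGJData NstxLike.kappa0 F NstxLike.Ra (NstxLike.q0 F) (NstxLike.ε / NstxLike.Ra) F r).MercierCriterion := by
  intro F hGF r hr
  have hF : 0 < F := lt_of_lt_of_le hG hGF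
  obtain ⟨h2, h0⟩ := lcRegNum_nstx hF r
  have h2r : 2 * r < NstxLike.Ra := by linarith [hr.2, NstxLike.edge_minorRadius.2]
  refine mercierCriterion_lcGGJData_of_regular NstxLike.Ra_pos NstxLike.kappa0_pos hF (NstxLike.q0_pos hF) hr.1 h2r
    hG.le hGF ?_
  rw [h2, h0]
  exact h r hr



/-- The EXACT near-axis Mercier threshold of the NSTX-like model in the free constant `F`:
`F_M = √(κ₀(κ₀+1)(κ₀²+1)/(2r_q(κ₀²+3κ₀−2)))`, `κ₀ = elongationOnAxis`, `r_q = q₀²/F² = NstxLike.q0SqOverFSq`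
(`= 1/√(r_q·bound κ₀ 0 0 1)`). [cite: Bateman1978, §7.3 eq. (7.3.2)] -/
def FmercAxis : ℝ := Real.sqrt (NstxLike.kappa0 * (NstxLike.kappa0 + 1) * (NstxLike.kappa0 ^ 2 + 1) / (2 * NstxLike.q0SqOverFSq * (NstxLike.kappa0 ^ 2 + 3 * NstxLike.kappa0 - 2)))

/-- `κ₀² + 3κ₀ > 2` (indeed `κ₀² ≈ 4.059`). [folklore] -/
theorem kappa0_regular : 2 < NstxLike.kappa0 ^ 2 + 3 * NstxLike.kappa0 := by
  have h1 : NstxLike.kappa0 ^ 2 = (3382585600 / 833319279 : ℝ) := by rw [NstxLike.kappa0_sq]; rfl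
  nlinarith [NstxLike.kappa0_pos, h1]

/-- The radicand of `F_M` is positive. [folklore] -/
theorem FmercAxis_sq_pos :
    0 < NstxLike.kappa0 * (NstxLike.kappa0 + 1) * (NstxLike.kappa0 ^ 2 + 1) / (2 * NstxLike.q0SqOverFSq * (NstxLike.kappa0 ^ 2 + 3 * NstxLike.kappa0 - 2)) := by
  have hk := NstxLike.kappa0_pos
  have h2 : 0 < NstxLike.kappa0 ^ 2 + 3 * NstxLike.kappa0 - 2 := by linarith [kappa0_regular]
  have hr : 0 < NstxLike.q0SqOverFSq := by unfold NstxLike.q0SqOverFSq; norm_num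
  positivity

/-- **Bateman's near-axis criterion on the instance is the threshold `F_M < F`** (`F > 0`). [cite: Bateman1978, §7.3 eq. (7.3.2)] -/
theorem mercierNearAxis_iff {F : ℝ} (hF : 0 < F) : MercierCriterion (NstxLike.q0 F) NstxLike.kappa0 0 0 ↔ FmercAxis < F := by
  have hk := NstxLike.kappa0_pos
  have h2 : 0 < NstxLike.kappa0 ^ 2 + 3 * NstxLike.kappa0 - 2 := by linarith [kappa0_regular]
  have hr : 0 < NstxLike.q0SqOverFSq := by unfold NstxLike.q0SqOverFSq; norm_num
  have hrad := FmercAxis_sq_pos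
  have hq : NstxLike.q0 F ^ 2 = F ^ 2 * NstxLike.q0SqOverFSq := NstxLike.q0_sq F
  -- both sides ↔ κ₀(κ₀+1)(κ₀²+1) < 2F²r_q(κ₀²+3κ₀−2)
  have hP : MercierCriterion (NstxLike.q0 F) NstxLike.kappa0 0 0
      ↔ 0 < 2 * F ^ 2 * NstxLike.q0SqOverFSq * (NstxLike.kappa0 ^ 2 + 3 * NstxLike.kappa0 - 2) - NstxLike.kappa0 * (NstxLike.kappa0 + 1) * (NstxLike.kappa0 ^ 2 + 1) := by
    unfold MercierCriterion bound
    rw [← sub_pos, hq]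
    have e : 6 / (1 + NstxLike.kappa0 ^ 2) - 4 / (NstxLike.kappa0 * (NstxLike.kappa0 + 1)) + 0 * (4 / (NstxLike.kappa0 * (NstxLike.kappa0 + 1)) - 2)
        + (NstxLike.kappa0 ^ 2 - 1) / (NstxLike.kappa0 ^ 2 + 1) * 0 - 1 / (F ^ 2 * NstxLike.q0SqOverFSq)
        = 1 / ((1 + NstxLike.kappa0 ^ 2) * NstxLike.kappa0 * (NstxLike.kappa0 + 1) * F ^ 2 * NstxLike.q0SqOverFSq)
          * (2 * F ^ 2 * NstxLike.q0SqOverFSq * (NstxLike.kappa0 ^ 2 + 3 * NstxLike.kappa0 - 2) - NstxLike.kappa0 * (NstxLike.kappa0 + 1) * (NstxLike.kappa0 ^ 2 + 1)) := by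
      field_simp; ring
    rw [e, mul_pos_iff_of_pos_left (by positivity)]
  have hQ : FmercAxis < F
      ↔ 0 < 2 * F ^ 2 * NstxLike.q0SqOverFSq * (NstxLike.kappa0 ^ 2 + 3 * NstxLike.kappa0 - 2) - NstxLike.kappa0 * (NstxLike.kappa0 + 1) * (NstxLike.kappa0 ^ 2 + 1) := by
    unfold FmercAxis
    rw [Real.sqrt_lt' hF, div_lt_iff₀ (by positivity), ← sub_pos]
    constructor <;> intro h <;> linarith
  exact hP.trans hQ.symm

/-- **The exact axis threshold lies in the certified bracket: `FmercLo ≤ F_M < FmercHi`** (from the two certified axis rows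
`mercier_elong_of_le`, `not_mercier_elong_of_le` of `…MercierAxis`; width `≤ 10⁻²⁰`). [cite: Bateman1978, §7.3 eq. (7.3.2)] -/
theorem FmercAxis_mem : MercierAxis.FmercLo ≤ FmercAxis ∧ FmercAxis < MercierAxis.FmercHi := by
  have hlo : 0 < MercierAxis.FmercLo := by unfold MercierAxis.FmercLo; norm_num
  have hhi : 0 < MercierAxis.FmercHi := by unfold MercierAxis.FmercHi; norm_num
  have e1 : MercierAxis.elong = NstxLike.kappa0 := rfl
  have eq : ∀ F, MercierAxis.q0 F = NstxLike.q0 F := fun F => rfl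
  constructor
  · have h := MercierAxis.not_mercier_elong_of_le hlo le_rfl
    rw [e1, eq, mercierNearAxis_iff hlo, not_lt] at h
    exact h
  · have h := MercierAxis.mercier_elong_of_le (le_refl MercierAxis.FmercHi)
    rw [e1, eq, mercierNearAxis_iff hhi] at h
    exact h

/-- **THE FLUX-SURFACE MERCIER THRESHOLD CONVERGES TO THE AXIS THRESHOLD:** for every `F > 0`, the threshold `g_M(r)` of
Jardin's (8.134) on the surface `r` of the NSTX-like model (record `lcGGJData κ₀ F R_a (q₀ F) (NstxLike.ε/R_a) · r`, `F`-free threshold)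
tends to `F_M` as `r → 0⁺`. [cite: Jardin2010, §8.5.4 eq. (8.134)] -/
theorem tendsto_mercierThreshold_axis {F : ℝ} (hF : 0 < F) :
    Tendsto (fun r => lcMercierThreshold NstxLike.kappa0 F NstxLike.Ra (NstxLike.q0 F) (NstxLike.ε / NstxLike.Ra) r) (𝓝[>] 0) (𝓝 FmercAxis) := by
  have h := tendsto_lcMercierThreshold_axis_closedForm NstxLike.Ra_pos NstxLike.kappa0_pos hF (NstxLike.q0_pos hF) (NstxLike.ε / NstxLike.Ra) kappa0_regular
  have hq : NstxLike.q0 F ^ 2 = F ^ 2 * NstxLike.q0SqOverFSq := NstxLike.q0_sq F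
  have hr : NstxLike.q0SqOverFSq ≠ 0 := by unfold NstxLike.q0SqOverFSq; norm_num
  have h2 : NstxLike.kappa0 ^ 2 + 3 * NstxLike.kappa0 - 2 ≠ 0 := by linarith [kappa0_regular]
  have e : F ^ 2 * NstxLike.kappa0 * (NstxLike.kappa0 + 1) * (NstxLike.kappa0 ^ 2 + 1) / (2 * NstxLike.q0 F ^ 2 * (NstxLike.kappa0 ^ 2 + 3 * NstxLike.kappa0 - 2))
      = NstxLike.kappa0 * (NstxLike.kappa0 + 1) * (NstxLike.kappa0 ^ 2 + 1) / (2 * NstxLike.q0SqOverFSq * (NstxLike.kappa0 ^ 2 + 3 * NstxLike.kappa0 - 2)) := by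
    rw [hq]; field_simp
  unfold FmercAxis
  rw [← e]
  exact h

/-- **Above the axis threshold (`F_M < F`) the flux-surface Mercier criterion (8.134) holds on EVERY surface of the NSTX-like
model sufficiently close to the magnetic axis.** [cite: Jardin2010, §8.5.4 eq. (8.134)] -/
theorem eventually_mercier_of_lt {F : ℝ} (hF : FmercAxis < F) :
    ∀ᶠ r in 𝓝[>] (0 : ℝ), (lcGGJData NstxLike.kappa0 F NstxLike.Ra (NstxLike.q0 F) (NstxLike.ε / NstxLike.Ra) F r).MercierCriterion := by
  have hF0 : 0 < F := lt_of_le_of_lt (Real.sqrt_nonneg _) hF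
  have hB : MercierCriterion (F * NstxLike.q0 F / F) NstxLike.kappa0 0 0 := by
    rw [mul_div_cancel_left₀ _ hF0.ne']
    exact (mercierNearAxis_iff hF0).2 hF
  exact eventually_mercierCriterion_of_nearAxis NstxLike.Ra_pos NstxLike.kappa0_pos hF0 (NstxLike.q0_pos hF0) (NstxLike.ε / NstxLike.Ra) hF0 hB

/-- **UNIFORM VERSION:** above the axis threshold there is ONE neighbourhood of the axis on which the flux-surface criterion
holds for EVERY larger free constant: `F_M < G ⇒ ∀ᶠ r → 0⁺, ∀ F ≥ G, (8.134)` on the surface `r`.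
[cite: Jardin2010, §8.5.4 eq. (8.134)] -/
theorem eventually_forall_mercier_of_lt {G : ℝ} (hG : FmercAxis < G) :
    ∀ᶠ r in 𝓝[>] (0 : ℝ), ∀ F, G ≤ F →
      (lcGGJData NstxLike.kappa0 F NstxLike.Ra (NstxLike.q0 F) (NstxLike.ε / NstxLike.Ra) F r).MercierCriterion := by
  have hG0 : 0 < G := lt_of_le_of_lt (Real.sqrt_nonneg _) hG
  have hB : MercierCriterion (G * NstxLike.q0 G / G) NstxLike.kappa0 0 0 := by
    rw [mul_div_cancel_left₀ _ hG0.ne']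
    exact (mercierNearAxis_iff hG0).2 hG
  have hev := eventually_regular_of_nearAxis NstxLike.Ra_pos NstxLike.kappa0_pos hG0 (NstxLike.q0_pos hG0) hG0 hB
  filter_upwards [hev] with r hr F hGF
  have hF : 0 < F := lt_of_lt_of_le hG0 hGF
  obtain ⟨h2G, h0G⟩ := lcRegNum_nstx hG0 r
  obtain ⟨h2F, h0F⟩ := lcRegNum_nstx hF r
  have h2r : 2 * r < NstxLike.Ra := by linarith [hr.1.2]
  refine mercierCriterion_lcGGJData_of_regular NstxLike.Ra_pos NstxLike.kappa0_pos hF (NstxLike.q0_pos hF) hr.1.1 h2r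
    hG0.le hGF ?_
  rw [h2F, h0F, ← h2G, ← h0G]
  exact hr.2

/-- In particular for every `F ≥ FmercHi` (the certified upper end of the axis bracket, `≈ 1.1185514845776`).
[cite: Jardin2010, §8.5.4 eq. (8.134)] -/
theorem eventually_mercier_of_le {F : ℝ} (hF : MercierAxis.FmercHi ≤ F) :
    ∀ᶠ r in 𝓝[>] (0 : ℝ), (lcGGJData NstxLike.kappa0 F NstxLike.Ra (NstxLike.q0 F) (NstxLike.ε / NstxLike.Ra) F r).MercierCriterion :=
  eventually_mercier_of_lt (lt_of_lt_of_le FmercAxis_mem.2 hF)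

/-- **Below the axis threshold (`0 < F < F_M`) the flux-surface criterion FAILS on every surface sufficiently close to the
axis.** [cite: Jardin2010, §8.5.4 eq. (8.134)] -/
theorem eventually_not_mercier_of_lt {F : ℝ} (hF0 : 0 < F) (hF : F < FmercAxis) :
    ∀ᶠ r in 𝓝[>] (0 : ℝ), ¬ (lcGGJData NstxLike.kappa0 F NstxLike.Ra (NstxLike.q0 F) (NstxLike.ε / NstxLike.Ra) F r).MercierCriterion := by
  have hk := NstxLike.kappa0_pos
  have h2 : 0 < NstxLike.kappa0 ^ 2 + 3 * NstxLike.kappa0 - 2 := by linarith [kappa0_regular]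
  have hr : 0 < NstxLike.q0SqOverFSq := by unfold NstxLike.q0SqOverFSq; norm_num
  have hq : NstxLike.q0 F ^ 2 = F ^ 2 * NstxLike.q0SqOverFSq := NstxLike.q0_sq F
  have hB : bound NstxLike.kappa0 0 0 1 < 1 / (F * NstxLike.q0 F / F) ^ 2 := by
    rw [mul_div_cancel_left₀ _ hF0.ne', hq]
    have hlt : F ^ 2 < NstxLike.kappa0 * (NstxLike.kappa0 + 1) * (NstxLike.kappa0 ^ 2 + 1) / (2 * NstxLike.q0SqOverFSq * (NstxLike.kappa0 ^ 2 + 3 * NstxLike.kappa0 - 2)) := by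
      have := hF
      unfold FmercAxis at this
      rw [Real.lt_sqrt hF0.le] at this
      exact this
    rw [lt_div_iff₀ (by positivity)] at hlt
    unfold bound
    rw [← sub_pos]
    have e : 1 / (F ^ 2 * NstxLike.q0SqOverFSq) - (6 / (1 + NstxLike.kappa0 ^ 2) - 4 / (NstxLike.kappa0 * (NstxLike.kappa0 + 1))
        + 0 * (4 / (NstxLike.kappa0 * (NstxLike.kappa0 + 1)) - 2) + (NstxLike.kappa0 ^ 2 - 1) / (NstxLike.kappa0 ^ 2 + 1) * 0)
        = 1 / ((1 + NstxLike.kappa0 ^ 2) * NstxLike.kappa0 * (NstxLike.kappa0 + 1) * F ^ 2 * NstxLike.q0SqOverFSq)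
          * (NstxLike.kappa0 * (NstxLike.kappa0 + 1) * (NstxLike.kappa0 ^ 2 + 1) - 2 * F ^ 2 * NstxLike.q0SqOverFSq * (NstxLike.kappa0 ^ 2 + 3 * NstxLike.kappa0 - 2)) := by
      field_simp; ring
    rw [e, mul_pos_iff_of_pos_left (by positivity)]
    linarith
  exact eventually_not_mercierCriterion_of_nearAxis_lt NstxLike.Ra_pos NstxLike.kappa0_pos hF0 (NstxLike.q0_pos hF0) (NstxLike.ε / NstxLike.Ra) hF0 hB

/-- In particular for every `0 < F < FmercLo` (the certified lower end of the axis bracket).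
[cite: Jardin2010, §8.5.4 eq. (8.134)] -/
theorem eventually_not_mercier_of_lt_FmercLo {F : ℝ} (hF0 : 0 < F) (hF : F < MercierAxis.FmercLo) :
    ∀ᶠ r in 𝓝[>] (0 : ℝ), ¬ (lcGGJData NstxLike.kappa0 F NstxLike.Ra (NstxLike.q0 F) (NstxLike.ε / NstxLike.Ra) F r).MercierCriterion :=
  eventually_not_mercier_of_lt hF0 (lt_of_lt_of_le hF FmercAxis_mem.1)

end Summit.Ventures.FusionMHD.Bench.SolovevPCFNstx.MercierAxisLimit

end
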